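import Literature.Topology.FourManifolds.LeeRasmussenAntiBigonProofs
import Literature.Topology.FourManifolds.GaussDiagramsRegularPosition
import HarnessLib

/-!
# Rasmussen's `s(K)` is well defined, from Reidemeister's theorem for the full oriented move set

Companion of `LeeRasmussen.lean` (`Knot.existsUnique_hasRasmussenInvariant`) and of
`GaussDiagramsRMoves.lean`. The prelude derives existence and uniqueness of `s(K)` from three
hypotheses: generic projections exist (`Knot.exists_hasGaussDiagram_of_isIsotopic`, since PROVED:
`exists_hasGaussDiagram_of_isIsotopic_holds`, `GaussDiagramsRegularPosition`), Reidemeister's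
theorem in the form `Knot.reidemeister` (isotopic knots have `GaussDiagram.Equiv`-alent diagrams,
i.e. related by the move set `PolyakMove`), and invariance of `s` under `Equiv`
(`rasmussenInvariant_eq_of_equiv`, PROVED). As recorded in `GaussDiagramsRMoves.lean`, the direction
of `Knot.reidemeister` used there ("isotopic ⇒ `Equiv`") is NOT covered by the theorems it cites:
`PolyakMove` has the braid-like third move `Ω3b` but not the anti-parallel second moves `Ω2c/Ω2d`,
and by Polyak (2010), Thm. 1.2 such a set does not generate all oriented Reidemeister moves (whether
it nevertheless relates all diagrams of isotopic knots is the open question of Audoux–Fiedler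
(2005), §1). The statement that IS Reidemeister's theorem is the one for the enlarged move set
`RMove`/`REquiv` (documented there as `Knot.reidemeisterR`).

This file declares that statement as a named fact and re-derives the well-definedness of `s(K)`
from it alone, using the invariance of `s` under `REquiv` between
realisable diagrams (`GaussDiagram.rasmussenInvariant_eq_of_rEquiv`, `LeeRasmussenAntiBigonProofs`):

* `Knot.reidemeisterR` (named fact; Reidemeister (1927) + Polyak (2010), Thm. 1.2 for `→`,
  Goussarov–Polyak–Viro (2000), Thm. 1.B for `←`): knots with Gauss diagrams `G, G'` are isotopic iff
  `G.REquiv G'` — verbatim the statement documented at the end of `GaussDiagramsRMoves.lean`;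
  `HasGaussDiagram.isIsotopic_of_reidemeisterR` (a realised Gauss diagram determines the knot);
* `Knot.existsUnique_hasRasmussenInvariant_of_rEquiv` — **every knot has exactly one Rasmussen
  invariant**, conditional only on that fact (and the isotopy bookkeeping
  `[SphereEmbedding.IsotopyFacts 1 3]` of the prelude);
* `Knot.HasRasmussenInvariant.eq_of_rEquiv` — two Rasmussen invariants of one knot are equal;
  `Knot.HasRasmussenInvariant.eq_rasmussenInvariant_of_rEquiv` — the invariant is read on ANY
  regular projection of the knot itself.

## References

* K. Reidemeister, *Elementare Begründung der Knotentheorie*, Abh. Math. Sem. Univ. Hamburg 5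
  (1927) 24–32 (isotopic diagrams are related by the three moves). [cite: Reidemeister1927]
* M. Polyak, *Minimal generating sets of Reidemeister moves*, Quantum Topol. 1 (2010) 399–411,
  Thm. 1.2 (`{Ω1a, Ω1b, Ω2c, Ω2d, Ω3b}` generates all oriented Reidemeister moves; each is an
  `RMove`). [cite: Polyak2010, Thm 1.2]
* J. Rasmussen, *Khovanov homology and the slice genus*, Invent. Math. 182 (2010), Thm. 1 (`s` is a
  knot invariant). [cite: Rasmussen2010, Thm. 1]
* B. Audoux, T. Fiedler, *A Jones polynomial for braid-like isotopies of oriented links*, Algebr.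
  Geom. Topol. 5 (2005), §1 (the question whether braid-like moves and all first moves suffice).
  [cite: AudouxFiedler2005, §1]
-/

open Function Set

noncomputable section

namespace Literature.Topology.FourManifolds

namespace Knot

/-- **Reidemeister's theorem, Gauss diagram form, for the full oriented move set.** If the knots
`K, K'` have Gauss diagrams `G, G'`, then `K` and `K'` are (ambient) isotopic iff `G` and `G'` are
related by the moves of `GaussDiagram.RMove` and their inverses (`GaussDiagram.REquiv`), possibly
through non-realisable diagrams. (`→`: isotopic knot diagrams are related by plane isotopy and the
three Reidemeister moves, Reidemeister (1927); every oriented Reidemeister move is a composite of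
`Ω1a, Ω1b, Ω2c, Ω2d, Ω3b`, Polyak (2010), Thm. 1.2, each of which — like the change of base point
and the renumbering, `relabel` — is an `RMove` on Gauss diagrams. `←`: Goussarov–Polyak–Viro
(2000), Thm. 1.B: realisable Gauss diagrams related by Reidemeister moves of Gauss diagrams,
possibly through non-realisable ones, present isotopic knots.) This is verbatim the corrected
statement `Knot.reidemeisterR` documented (not declared) at the end of `GaussDiagramsRMoves.lean`,
to be used in place of `Knot.reidemeister`, whose move set `PolyakMove` lacks `Ω2c/Ω2d`.
K. Reidemeister, Abh. Math. Sem. Hamburg 5 (1927) 24–32; M. Polyak, Quantum Topol. 1 (2010),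
Thm. 1.2; GPV, Topology 39 (2000), Thm. 1.B. [cite: Reidemeister1927] -/
def reidemeisterR : Prop :=
  ∀ {K K' : Knot} {G G' : GaussDiagram}, K.HasGaussDiagram G → K'.HasGaussDiagram G' →
    (K.IsIsotopic K' ↔ G.REquiv G')

/-- Knots with a common Gauss diagram are isotopic (a realisable signed Gauss diagram determines
the knot type); special case of `Knot.reidemeisterR` (hypothesis `hR`). GPV (2000), Thm. 1.B.
[cite: GPV2000] -/
theorem HasGaussDiagram.isIsotopic_of_reidemeisterR (hR : Knot.reidemeisterR) {K K' : Knot}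
    {G : GaussDiagram} (h : K.HasGaussDiagram G) (h' : K'.HasGaussDiagram G) : K.IsIsotopic K' :=
  (hR h h').2 (GaussDiagram.REquiv.refl G)

/-- **Rasmussen's `s(K)` is a well-defined knot invariant** — every knot has exactly one Rasmussen
invariant — from Reidemeister's theorem in its oriented `RMove` form alone (hypothesis `hR`, the
named fact `Knot.reidemeisterR`, of which only the direction `→` is used): existence by the proved genericity
`exists_hasGaussDiagram_of_isIsotopic_holds`, uniqueness by `hR` and the proved invariance of `s`
under `REquiv` between realisable diagrams (`GaussDiagram.rasmussenInvariant_eq_of_rEquiv`);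
symmetry and transitivity of isotopy are `[SphereEmbedding.IsotopyFacts 1 3]` as in the prelude.
Compare `Knot.existsUnique_hasRasmussenInvariant` (hypotheses `Knot.reidemeister`,
`rasmussenInvariant_eq_of_equiv`). Rasmussen (2010), Thm. 1. [cite: Rasmussen2010, Thm. 1] -/
theorem existsUnique_hasRasmussenInvariant_of_rEquiv [SphereEmbedding.IsotopyFacts 1 3]
    (hR : Knot.reidemeisterR) (K : Knot) : ∃! s, K.HasRasmussenInvariant s := by
  obtain ⟨K', D, hK', hD⟩ := exists_hasGaussDiagram_of_isIsotopic_holds K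
  refine ⟨D.rasmussenInvariant, ⟨K', D, hK', hD, rfl⟩, ?_⟩
  rintro s ⟨K'', D', hK'', hD', rfl⟩
  exact GaussDiagram.rasmussenInvariant_eq_of_rEquiv ⟨K'', hD'⟩ ⟨K', hD⟩
    ((hR hD' hD).1 (SphereEmbedding.IsotopyFacts.trans (SphereEmbedding.IsotopyFacts.symm hK'') hK'))

/-- **Two Rasmussen invariants of one knot are equal** (uniqueness half, same hypothesis).
[cite: Rasmussen2010, Thm. 1] -/
theorem HasRasmussenInvariant.eq_of_rEquiv [SphereEmbedding.IsotopyFacts 1 3]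
    (hR : Knot.reidemeisterR) {K : Knot} {s s' : ℤ} (h : K.HasRasmussenInvariant s)
    (h' : K.HasRasmussenInvariant s') : s = s' :=
  (existsUnique_hasRasmussenInvariant_of_rEquiv hR K).unique h h'

/-- **The Rasmussen invariant is read on any regular projection of the knot itself**: if
`K.HasRasmussenInvariant s` then `s` is the invariant of the Gauss diagram of every regular
projection `P` of `K` (same hypothesis). [cite: Rasmussen2010, Thm. 1] -/
theorem HasRasmussenInvariant.eq_rasmussenInvariant_of_rEquiv [SphereEmbedding.IsotopyFacts 1 3]
    (hR : Knot.reidemeisterR) {K : Knot} {s : ℤ} (h : K.HasRasmussenInvariant s)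
    (P : K.RegularProjection) : s = P.diagram.rasmussenInvariant :=
  h.eq_of_rEquiv hR ⟨K, P.diagram, SphereEmbedding.IsIsotopic.refl K, ⟨P, rfl⟩, rfl⟩

end Knot

end Literature.Topology.FourManifolds
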